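import Summits.BirchSwinnertonDyer.BirchSwinnertonDyer.Theorems.ByReductionTypeAtTwoAdditivePotGoodLowerHalfOrderWitness
import Literature.Algebra.Module.AlternatingPairingParity
import Literature.GroupTheory.FiniteAbelian.NonCyclicSubgroup
import Literature.NumberTheory.EllipticCurves.BSDRankZeroDensityProofs
import HarnessLib

/-!
# K4 crux `AdditiveRankZeroAtTwo` (item 19098), child C3″ `AdditivePotGoodLowerHalfAtTwo` (item 22617):
# the order-witness road is EXACT on the census rows — with `#Ш[p] ≤ p²` (first descent: `dim Sel_p = t + 2`
# in rank `0`) Cassels–Tate makes `Ш[p^∞] ≅ (ℤ/p^m)²`, so `ord_p #Ш = 2 · max ord_p (ord x)`; the LOWER half is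
# «one element of order `p^{⌈a/2⌉}`», the UPPER half is «no element of order `p^{a/2+1}`» (Kato-free), `a = ord_p #Ш_an`

Cell `bsd-2adic`, seat `bsd-2adic-k4-w2` GEN 0; `--supports stmt-BirchSwinnertonDyer-22617 --as helper`; sequel of
`…LowerHalfOrderWitness.lean` (p650635). HONEST FRAMING: conditional theorems (published inputs BY NAME + per-row
certificate SLOTS: the first-descent count `#Sel₂ = 2^s`, `#E(ℚ)[2] = 2^t`, `s ≤ t + 2`, and an element of `Ш` resp. a
bound on the `2`-power orders of the elements of `Ш` — OBJECTS a descent exhibits outside the kernel); closes nothing at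
the `∀`-level; nothing booked; BSD is not proved by any of this.

WHAT THIS FILE DOES.
* §1 (pure algebra, `Literature.GroupTheory.FiniteAbelian`): a finite abelian group `L` with `#L[p] ≤ p` has an element
  `a` with `ord_p (ord a) = ord_p #L` (its `p`-primary component is cyclic: the tree's `p`-torsion criterion
  `isAddCyclic_iff_natCard_torsionBy_le`); hence a symplectic module `T ≅ L × L` (`exists_addEquiv_prod_self`) with
  `#T[p] ≤ p²` has an element `x` with `2 · ord_p (ord x) = ord_p #T` — the bound of p650635
  (`two_mul_padicValNat_addOrderOf_le_of_alternating`) is ATTAINED (`exists_two_mul_padicValNat_addOrderOf_eq_of_alternating`),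
  and `ord_p #T ≤ 2k` as soon as every element has `ord_p (ord x) ≤ k`.
* §2 (`WeierstrassCurve`, any number field): for `Ш(E/K)` finite with the Cassels–Tate fact and `#Ш[p] ≤ p²`:
  `∃ x ∈ Ш, 2 · ord_p (ord x) = ord_p #Ш`; and `#Ш[p] ≤ p²` from the first-descent count in rank `0`
  (`natCard_selmerGroup_eq`, Silverman X.4.2, PROVED in the tree).
* §3 (over `ℚ`, analytic rank `≤ 1`): on such rows `MissingLowerBoundAt W p ⟺ ∃` order witness
  (`missingLowerBoundAt_iff_orderWitness_of_sha_torsionBy_le`), and `MissingUpperBoundAt W p ⟸` «every `x ∈ Ш(W)` has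
  `ord_p (ord x) ≤ k`» with `2k ≤ ord_p #Ш_an` (`missingUpperBoundAt_of_forall_padicValNat_addOrderOf_le`) — an
  Euler-system-free road into the UPPER half, fed by a `p^{k+1}`-descent.
* §4 keyed to C3″: at a row of `AdditivePotGoodLowerHalfAtTwo` carrying the first-descent datum `s ≤ t + 2`
  (census: `s = t + 2` on 6 643 / 6 643 X5 members, two engines, CERT-SEL2-AB-X5ALL), the child's conclusion
  `MissingLowerBoundAt W 2` is EQUIVALENT to «`Ш(W)` has an element `x` with `ord₂ #Ш_an(W) ≤ 2 · ord₂ (ord x)`»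
  (`addPotGoodLower_two_iff_orderWitness_of_selmerTwo`): on the census the order witness of p650635 is not merely
  sufficient but exactly the content of C3″, row by row.

References: [Wall1963QuadraticFormsFiniteGroups] Lemma 7; [TignolAmitsur1986SymplecticModules] Thm. 4.1;
[Hungerford1974] Ch. II §2 Exercise 1; [SilvermanAEC2009] Thm. X.4.2, Thm. X.4.14; [Miller2011LMS] Def. 1.1;
[GrossZagier1986], [Kolyvagin1990].
-/

set_option autoImplicit false
set_option linter.dupNamespace false

noncomputable section

open scoped Classical AddSubgroup

/-! ## §1 Pure algebra: cyclic `p`-part from small `p`-torsion; the symplectic bound is attained -/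

namespace Literature.GroupTheory.FiniteAbelian

universe u v

/-- In the additive `p`-primary component, the `q`-torsion is trivial for every prime `q ≠ p` (its elements
have `p`-power order). [folklore] -/
theorem torsionBy_primaryComponent_eq_bot_of_ne {L : Type u} [AddCommGroup L] (p : ℕ) [hp : Fact p.Prime]
    {q : ℕ} (hq : q.Prime) (hqp : q ≠ p) :
    AddSubgroup.torsionBy (AddCommGroup.primaryComponent L p) (q : ℤ) = ⊥ := by
  rw [eq_bot_iff]
  intro x hx
  rw [AddSubgroup.mem_bot]
  have hq0 : q • x = 0 := AddSubgroup.torsionBy.nsmul_iff.mp hx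
  obtain ⟨n, hn⟩ := (AddCommGroup.mem_primaryComponent_iff_addOrderOf (p := p)).mp x.2
  have hx' : addOrderOf x = p ^ n := by rw [← AddSubgroup.addOrderOf_coe, hn]
  have h1 : p ^ n ∣ q := hx' ▸ addOrderOf_dvd_of_nsmul_eq_zero hq0
  have hn0 : n = 0 := by
    by_contra h
    have hpq : p ∣ q := (dvd_pow_self p h).trans h1
    exact hqp ((Nat.prime_dvd_prime_iff_eq hp.out hq).mp hpq).symm
  rw [hn0, pow_zero] at hx'
  exact AddMonoid.addOrderOf_eq_one_iff.mp hx'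

/-- **Small `p`-torsion ⇒ an element of full `p`-adic order.** A finite abelian group `L` with `#L[p] ≤ p` has
an element `a` with `ord_p (ord a) = ord_p #L`: the `p`-primary component `L(p)` has `#L(p)[p] = #L[p] ≤ p` and
trivial `q`-torsion for `q ≠ p`, so it is cyclic by the `p`-torsion criterion (Hungerford II §2 Ex. 1,
`isAddCyclic_iff_natCard_torsionBy_le`); a generator has order `#L(p) = p^{ord_p #L}`.
[cite: Hungerford1974, Ch. II §2 Exercise 1 (PDF p. 141)] -/
theorem exists_padicValNat_addOrderOf_eq_of_natCard_torsionBy_le {L : Type u} [AddCommGroup L] [Finite L]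
    (p : ℕ) [hp : Fact p.Prime] (hL : Nat.card (AddSubgroup.torsionBy L (p : ℤ)) ≤ p) :
    ∃ a : L, padicValNat p (addOrderOf a) = padicValNat p (Nat.card L) := by
  set P : AddSubgroup L := AddCommGroup.primaryComponent L p with hP
  haveI : Finite P := inferInstance
  have hcyc : IsAddCyclic P := by
    rw [isAddCyclic_iff_natCard_torsionBy_le]
    intro q hq
    by_cases hqp : q = p
    · subst hqp
      rw [hP, Literature.Algebra.Module.natCard_torsionBy_primaryComponent]
      exact hL
    · rw [hP, torsionBy_primaryComponent_eq_bot_of_ne p hq hqp, AddSubgroup.card_bot]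
      exact hq.one_lt.le
  obtain ⟨g, hg⟩ := IsAddCyclic.exists_ofOrder_eq_natCard (α := P)
  refine ⟨(g : L), ?_⟩
  rw [AddSubgroup.addOrderOf_coe, hg, hP, Literature.NumberTheory.EllipticCurves.card_addPrimaryComponent_eq_pow,
    padicValNat.prime_pow, Nat.factorization_def _ hp.out]

/-- `#(L × M)[n] = #L[n] · #M[n]` (`n : ℕ`): the `n`-torsion of a product is the product of the `n`-torsions.
[folklore] -/
theorem natCard_torsionBy_prod {L : Type u} {M : Type v} [AddCommGroup L] [AddCommGroup M] (n : ℕ) :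
    Nat.card (AddSubgroup.torsionBy (L × M) (n : ℤ)) =
      Nat.card (AddSubgroup.torsionBy L (n : ℤ)) * Nat.card (AddSubgroup.torsionBy M (n : ℤ)) := by
  rw [← Nat.card_prod]
  refine Nat.card_congr
    { toFun := fun x ↦ (⟨x.1.1, ?_⟩, ⟨x.1.2, ?_⟩)
      invFun := fun y ↦ ⟨(y.1.1, y.2.1), ?_⟩
      left_inv := fun x ↦ rfl
      right_inv := fun y ↦ rfl }
  · have h := AddSubgroup.torsionBy.nsmul_iff.mp x.2
    exact AddSubgroup.torsionBy.nsmul_iff.mpr (congrArg Prod.fst h)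
  · have h := AddSubgroup.torsionBy.nsmul_iff.mp x.2
    exact AddSubgroup.torsionBy.nsmul_iff.mpr (congrArg Prod.snd h)
  · exact AddSubgroup.torsionBy.nsmul_iff.mpr
      (Prod.ext (AddSubgroup.torsionBy.nsmul_iff.mp y.1.2) (AddSubgroup.torsionBy.nsmul_iff.mp y.2.2))

/-- `#T[n]` is invariant under `≃+`. [folklore] -/
theorem natCard_torsionBy_congr {T : Type u} {T' : Type v} [AddCommGroup T] [AddCommGroup T'] (e : T ≃+ T')
    (n : ℕ) : Nat.card (AddSubgroup.torsionBy T (n : ℤ)) = Nat.card (AddSubgroup.torsionBy T' (n : ℤ)) := by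
  refine Nat.card_congr
    { toFun := fun x ↦ ⟨e x.1, ?_⟩
      invFun := fun y ↦ ⟨e.symm y.1, ?_⟩
      left_inv := fun x ↦ Subtype.ext (e.symm_apply_apply x.1)
      right_inv := fun y ↦ Subtype.ext (e.apply_symm_apply y.1) }
  · exact AddSubgroup.torsionBy.nsmul_iff.mpr
      (by rw [← map_nsmul, AddSubgroup.torsionBy.nsmul_iff.mp x.2, map_zero])
  · exact AddSubgroup.torsionBy.nsmul_iff.mpr
      (by rw [← map_nsmul, AddSubgroup.torsionBy.nsmul_iff.mp y.2, map_zero])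

/-- **The symplectic bound is attained when `#T[p] ≤ p²`.** A finite abelian group `T` with a nondegenerate
alternating `ℚ/ℤ`-pairing and `#T[p] ≤ p²` has an element `x` with `2 · ord_p (ord x) = ord_p #T`: `T ≃+ L × L`
(Wall / Tignol–Amitsur), `#T[p] = (#L[p])²` forces `#L[p] ≤ p`, so `L` has an element `a` of full `p`-adic order,
and `x ↦ (a, 0)`. With p650635's `two_mul_padicValNat_addOrderOf_le_of_alternating` (`≤` for every `x`):
`ord_p #T = 2 · max_x ord_p (ord x)`, i.e. `T[p^∞] ≅ (ℤ/p^m)²`.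
[cite: Wall1963QuadraticFormsFiniteGroups, Lemma 7] [cite: Hungerford1974, Ch. II §2 Exercise 1 (PDF p. 141)] -/
theorem exists_two_mul_padicValNat_addOrderOf_eq_of_alternating {T : Type u} [AddCommGroup T] [Finite T]
    (B : T →+ T →+ AddCircle (1 : ℚ)) (halt : ∀ x, B x x = 0) (hnd : ∀ x, (∀ y, B x y = 0) → x = 0)
    (p : ℕ) [hp : Fact p.Prime] (hT : Nat.card (AddSubgroup.torsionBy T (p : ℤ)) ≤ p ^ 2) :
    ∃ x : T, 2 * padicValNat p (addOrderOf x) = padicValNat p (Nat.card T) := by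
  obtain ⟨L, -, ⟨e⟩⟩ := exists_addEquiv_prod_self B halt hnd
  haveI : Finite (L × L) := Finite.of_equiv T e.toEquiv
  haveI : Finite L := Finite.of_injective (fun a : L ↦ ((a, (0 : L)) : L × L)) fun a b h ↦ congrArg Prod.fst h
  have hLp : Nat.card (AddSubgroup.torsionBy L (p : ℤ)) ≤ p := by
    have h := hT
    rw [natCard_torsionBy_congr e p, natCard_torsionBy_prod, ← sq] at h
    exact (Nat.pow_le_pow_iff_left two_ne_zero).mp h
  obtain ⟨a, ha⟩ := exists_padicValNat_addOrderOf_eq_of_natCard_torsionBy_le p hLp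
  refine ⟨e.symm (a, 0), ?_⟩
  have hord : addOrderOf (e.symm (a, 0)) = addOrderOf a := by
    rw [AddEquiv.addOrderOf_eq, Prod.addOrderOf, addOrderOf_zero, Nat.lcm_one_right]
  have hL0 : Nat.card L ≠ 0 := (Nat.card_pos (α := L)).ne'
  rw [hord, ha, Nat.card_congr e.toEquiv, Nat.card_prod, padicValNat.mul hL0 hL0, two_mul]

/-- **No deep element ⇒ small group**: in a symplectic module with `#T[p] ≤ p²`, if every element has
`ord_p (ord x) ≤ k` then `ord_p #T ≤ 2k`. [cite: Wall1963QuadraticFormsFiniteGroups, Lemma 7] -/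
theorem padicValNat_natCard_le_two_mul_of_forall_of_alternating {T : Type u} [AddCommGroup T] [Finite T]
    (B : T →+ T →+ AddCircle (1 : ℚ)) (halt : ∀ x, B x x = 0) (hnd : ∀ x, (∀ y, B x y = 0) → x = 0)
    (p : ℕ) [hp : Fact p.Prime] (hT : Nat.card (AddSubgroup.torsionBy T (p : ℤ)) ≤ p ^ 2) {k : ℕ}
    (hk : ∀ x : T, padicValNat p (addOrderOf x) ≤ k) : padicValNat p (Nat.card T) ≤ 2 * k := by
  obtain ⟨x, hx⟩ := exists_two_mul_padicValNat_addOrderOf_eq_of_alternating B halt hnd p hT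
  rw [← hx]
  exact Nat.mul_le_mul_left 2 (hk x)

end Literature.GroupTheory.FiniteAbelian

/-! ## §2 `Ш(E/K)` with `#Ш[p] ≤ p²`: the Cassels–Tate square is cyclic-squared -/

namespace WeierstrassCurve

open Literature.NumberTheory.EllipticCurves Literature.GroupTheory.FiniteAbelian

universe u

variable {K : Type u} [Field K] [NumberField K]

/-- Nondegeneracy of the Cassels–Tate pairing on a FINITE `Ш` (kernel = divisible elements = `0`); the common
first step of p650635 §2, isolated. Conditional on the pairing fact `h`. [cite: SilvermanAEC2009, Thm. X.4.14] -/
theorem exists_alternating_nondegenerate_sha_of_casselsTate (h : exists_casselsTate_pairing (K := K))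
    (W : WeierstrassCurve K) [W.IsElliptic] [Finite W.sha] :
    ∃ B : W.sha →+ W.sha →+ AddCircle (1 : ℚ), (∀ x, B x x = 0) ∧ ∀ x, (∀ y, B x y = 0) → x = 0 := by
  obtain ⟨B, halt, hker⟩ := h W
  refine ⟨B, halt, fun a ha ↦ ?_⟩
  have hmem : a ∈ AddSubgroup.divisibleElements W.sha := (hker a).mp ha
  rwa [divisibleElements_eq_bot_of_finite, AddSubgroup.mem_bot] at hmem

/-- **`∃ x ∈ Ш(E/K)` with `2 · ord_p (ord x) = ord_p #Ш(E/K)`** when `Ш` is finite and `#Ш[p] ≤ p²`: the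
Cassels–Tate square `Ш[p^∞] ≅ L × L` is then `(ℤ/p^m)²` (§1). Conditional on the pairing fact `h` and the slot
`#Ш[p] ≤ p²`. [cite: SilvermanAEC2009, Thm. X.4.14] [cite: Wall1963QuadraticFormsFiniteGroups, Lemma 7] -/
theorem exists_two_mul_padicValNat_addOrderOf_eq_padicValNat_shaOrder_of_casselsTate
    (h : exists_casselsTate_pairing (K := K)) (W : WeierstrassCurve K) [W.IsElliptic] [Finite W.sha]
    (p : ℕ) [Fact p.Prime] (hSha : Nat.card (AddSubgroup.torsionBy W.sha (p : ℤ)) ≤ p ^ 2) :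
    ∃ x : W.sha, 2 * padicValNat p (addOrderOf x) = padicValNat p W.shaOrder := by
  obtain ⟨B, halt, hnd⟩ := exists_alternating_nondegenerate_sha_of_casselsTate h W
  rw [WeierstrassCurve.shaOrder]
  exact exists_two_mul_padicValNat_addOrderOf_eq_of_alternating B halt hnd p hSha

/-- **No deep element ⇒ `ord_p #Ш ≤ 2k`** (finite `Ш`, `#Ш[p] ≤ p²`, every `x ∈ Ш` with `ord_p (ord x) ≤ k`).
Conditional on the pairing fact `h` and the two slots. [cite: SilvermanAEC2009, Thm. X.4.14] -/
theorem padicValNat_shaOrder_le_two_mul_of_forall_of_casselsTate (h : exists_casselsTate_pairing (K := K))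
    (W : WeierstrassCurve K) [W.IsElliptic] [Finite W.sha] (p : ℕ) [Fact p.Prime]
    (hSha : Nat.card (AddSubgroup.torsionBy W.sha (p : ℤ)) ≤ p ^ 2) {k : ℕ}
    (hk : ∀ x : W.sha, padicValNat p (addOrderOf x) ≤ k) : padicValNat p W.shaOrder ≤ 2 * k := by
  obtain ⟨B, halt, hnd⟩ := exists_alternating_nondegenerate_sha_of_casselsTate h W
  rw [WeierstrassCurve.shaOrder]
  exact padicValNat_natCard_le_two_mul_of_forall_of_alternating B halt hnd p hSha hk

/-- **`#Ш[p] ≤ p²` from the first-descent count in rank `0`**: `#Sel^(p)(E/K) = p^s`, `#E(K)[p] = p^t`,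
`s ≤ t + 2` and `rank E(K) = 0` give `#Ш(E/K)[p] = p^{s-t} ≤ p²`, by the PROVED descent count
`#Sel^(p) = p^r · #E(K)[p] · #Ш[p]` (`natCard_selmerGroup_eq`, Silverman X.4.2). No pairing needed.
[cite: SilvermanAEC2009, Thm. X.4.2] -/
theorem natCard_sha_torsionBy_le_of_selmer_count (W : WeierstrassCurve K) [W.IsElliptic] (p : ℕ)
    [hp : Fact p.Prime] (hr : W.mordellWeilRank = 0) {s t : ℕ} (hs : Nat.card (W.selmerGroup p) = p ^ s)
    (ht : Nat.card (W.toAffine.Point[(p : ℤ)]) = p ^ t) (hst : s ≤ t + 2) :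
    Nat.card (AddSubgroup.torsionBy W.sha (p : ℤ)) ≤ p ^ 2 := by
  have hSel := W.natCard_selmerGroup_eq hp.out.ne_zero
  rw [hs, ht, hr, pow_zero, one_mul, ← Literature.Algebra.Module.natCard_torsionBy_addSubgroup] at hSel
  -- `p ^ s = p ^ t * #Ш[p]`, so `#Ш[p] ∣ p ^ s / p ^ t`-style: compare valuations via divisibility
  have hdvd : p ^ t * Nat.card (AddSubgroup.torsionBy W.sha (p : ℤ)) ∣ p ^ (t + 2) := by
    rw [← hSel]; exact pow_dvd_pow p hst
  rw [pow_add] at hdvd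
  exact Nat.le_of_dvd (pow_pos hp.out.pos 2) (Nat.dvd_of_mul_dvd_mul_left (pow_pos hp.out.pos t) hdvd)

end WeierstrassCurve

/-! ## §3 Exactness at a pair over `ℚ` in analytic rank `≤ 1` -/

namespace Summit.BirchSwinnertonDyer.BirchSwinnertonDyer.Theorems

open WeierstrassCurve Literature.NumberTheory.EllipticCurves
  Literature.NumberTheory.EllipticCurves.Rank1Residual
  Literature.NumberTheory.EllipticCurves.Rank1Residual.Typed
  Summit.BirchSwinnertonDyer.Rank1Residual.Additive

section Pair

variable (W : WeierstrassCurve ℚ) [W.IsElliptic] (p : ℕ) [hp : Fact p.Prime]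

/-- **On a row with `#Ш[p] ≤ p²` the lower half IS the order witness**: in analytic rank `≤ 1` (GZK `hGZK`:
`Ш(W)` finite), `MissingLowerBoundAt W p ⟺ ∃ q x, #Ш_an(W) = q ∧ ord_p q ≤ 2 · ord_p (ord x)` — `⟸` is p650635's
`missingLowerBoundAt_of_orderWitness_of_casselsTate`; `⟹` takes the element of §2 attaining `ord_p #Ш`. Conditional
on `hCT`, `hGZK` and the slot `#Ш[p] ≤ p²`. [cite: SilvermanAEC2009, Thm. X.4.14] [cite: Miller2011LMS, Def. 1.1] -/
theorem missingLowerBoundAt_iff_orderWitness_of_sha_torsionBy_le (hCT : exists_casselsTate_pairing (K := ℚ))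
    (hGZK : rank_eq_analyticRank_of_analyticRank_le_one) (hr : W.analyticRank ≤ 1)
    (hSha : Nat.card (AddSubgroup.torsionBy W.sha (p : ℤ)) ≤ p ^ 2) :
    MissingLowerBoundAt W p ↔
      ∃ (q : ℚ) (x : W.sha), shaAn W = (q : ℂ) ∧ padicValRat p q ≤ ((2 * padicValNat p (addOrderOf x) : ℕ) : ℤ) := by
  haveI : Finite W.sha := (hGZK W hr).2
  refine ⟨fun ⟨q, hq, hle⟩ ↦ ?_, fun ⟨q, x, hq, hv⟩ ↦
    missingLowerBoundAt_of_orderWitness_of_casselsTate W p hCT hGZK hr hq x hv⟩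
  obtain ⟨x, hx⟩ := exists_two_mul_padicValNat_addOrderOf_eq_padicValNat_shaOrder_of_casselsTate hCT W p hSha
  exact ⟨q, x, hq, by rw [hx]; exact hle⟩

/-- **The UPPER half from «no deep element», Euler-system-free**: in analytic rank `≤ 1`, on a row with
`#Ш[p] ≤ p²`, if `#Ш_an(W) = q` with `2k ≤ ord_p q` and every `x ∈ Ш(W)` has `ord_p (ord x) ≤ k` (the output of a
`p^{k+1}`-descent: `Ш[p^{k+1}] = Ш[p^k]`), then `ord_p #Ш(W) ≤ ord_p #Ш_an(W)`. No Kato / Kolyvagin input.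
Conditional on `hCT`, `hGZK` and the two slots. [cite: SilvermanAEC2009, Thm. X.4.14] [cite: Miller2011LMS, Def. 1.1] -/
theorem missingUpperBoundAt_of_forall_padicValNat_addOrderOf_le (hCT : exists_casselsTate_pairing (K := ℚ))
    (hGZK : rank_eq_analyticRank_of_analyticRank_le_one) (hr : W.analyticRank ≤ 1)
    (hSha : Nat.card (AddSubgroup.torsionBy W.sha (p : ℤ)) ≤ p ^ 2) {q : ℚ} (hq : shaAn W = (q : ℂ))
    {k : ℕ} (hkq : ((2 * k : ℕ) : ℤ) ≤ padicValRat p q) (hk : ∀ x : W.sha, padicValNat p (addOrderOf x) ≤ k) :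
    MissingUpperBoundAt W p := by
  haveI : Finite W.sha := (hGZK W hr).2
  have hle := padicValNat_shaOrder_le_two_mul_of_forall_of_casselsTate hCT W p hSha hk
  exact ⟨q, hq, le_trans (by exact_mod_cast hle) hkq⟩

/-- **`BSD(E,p)`'s missing output on such a row is «the `p`-exponent of `Ш` is exactly `p^{a/2}`»**: in analytic
rank `≤ 1`, on a row with `#Ш[p] ≤ p²`, `MissingPPartAt W p` holds iff `#Ш_an(W) = q` with `ord_p q = 2k` for a `k`
that is attained as `ord_p (ord x)` by some `x ∈ Ш(W)` and exceeded by none. Conditional on `hCT`, `hGZK` and the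
slot. [cite: SilvermanAEC2009, Thm. X.4.14] [cite: Miller2011LMS, Def. 1.1] -/
theorem missingPPartAt_iff_exponentWitness_of_sha_torsionBy_le (hCT : exists_casselsTate_pairing (K := ℚ))
    (hGZK : rank_eq_analyticRank_of_analyticRank_le_one) (hr : W.analyticRank ≤ 1)
    (hSha : Nat.card (AddSubgroup.torsionBy W.sha (p : ℤ)) ≤ p ^ 2) :
    MissingPPartAt W p ↔ ∃ (q : ℚ) (k : ℕ), shaAn W = (q : ℂ) ∧ padicValRat p q = ((2 * k : ℕ) : ℤ) ∧
      (∃ x : W.sha, padicValNat p (addOrderOf x) = k) ∧ ∀ y : W.sha, padicValNat p (addOrderOf y) ≤ k := by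
  haveI : Finite W.sha := (hGZK W hr).2
  obtain ⟨x, hx⟩ := exists_two_mul_padicValNat_addOrderOf_eq_padicValNat_shaOrder_of_casselsTate hCT W p hSha
  have hall : ∀ y : W.sha, padicValNat p (addOrderOf y) ≤ padicValNat p (addOrderOf x) := fun y ↦ by
    have h := two_mul_padicValNat_addOrderOf_le_padicValNat_shaOrder_of_casselsTate hCT W p y
    omega
  constructor
  · rintro ⟨q, hq, hv⟩
    exact ⟨q, padicValNat p (addOrderOf x), hq, by rw [hv, ← hx], ⟨x, rfl⟩, hall⟩
  · rintro ⟨q, k, hq, hv, ⟨x', hx'⟩, hk⟩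
    have hkk : k = padicValNat p (addOrderOf x) := le_antisymm (hx' ▸ hall x') (hk x)
    exact ⟨q, hq, by rw [hv, hkk, hx]⟩

end Pair

end Summit.BirchSwinnertonDyer.BirchSwinnertonDyer.Theorems

/-! ## §4 Keyed to C3″: on the census rows (first descent `s ≤ t + 2`) the order witness IS the child's content -/

namespace Summit.BirchSwinnertonDyer.BirchSwinnertonDyer.Theorems.AddKatoTwo

open WeierstrassCurve Literature.NumberTheory.EllipticCurves
  Literature.NumberTheory.EllipticCurves.Rank1Residual
  Literature.NumberTheory.EllipticCurves.Rank1Residual.Typed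
  Summit.BirchSwinnertonDyer.BirchSwinnertonDyer.Theorems
  Summit.BirchSwinnertonDyer.Rank1Residual.Additive
  Summit.BirchSwinnertonDyer.BirchSwinnertonDyer.Theses.ByReductionTypeAtTwo

/-- **C3″ at a census row ⟺ one order witness at that row.** Binders of the child verbatim (`W` globally minimal,
non-CM, analytic rank `0`, additive and potentially good at `2`; the reduction-type binders are carried, not used)
plus the FIRST-DESCENT datum of the row (`#Sel₂(W) = 2^s`, `#W(ℚ)[2] = 2^t`, `s ≤ t + 2`; census: `s = t + 2` on every
X5 member): then `MissingLowerBoundAt W 2 ⟺ ∃ q x, #Ш_an(W) = q ∧ ord₂ q ≤ 2 · ord₂ (ord x)`. GZK gives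
`rank W(ℚ) = 0` and `Ш(W)` finite. Conditional on `hCT`, `hGZK` and the descent slot.
[cite: SilvermanAEC2009, Thm. X.4.2 and Thm. X.4.14] [cite: Miller2011LMS, Def. 1.1] -/
theorem addPotGoodLower_two_iff_orderWitness_of_selmerTwo (hCT : exists_casselsTate_pairing (K := ℚ))
    (hGZK : rank_eq_analyticRank_of_analyticRank_le_one) (W : WeierstrassCurve ℚ) [W.IsElliptic]
    [W.IsGloballyMinimal] (_hcm : ¬ W.HasCM) (hr : W.analyticRank = 0) (_hadd : Addv W 2)
    (_hj : 0 ≤ padicValRat 2 W.j) {s t : ℕ} (hs : Nat.card (W.selmerGroup 2) = 2 ^ s)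
    (ht : Nat.card (W.toAffine.Point[(2 : ℤ)]) = 2 ^ t) (hst : s ≤ t + 2) :
    MissingLowerBoundAt W 2 ↔
      ∃ (q : ℚ) (x : W.sha), shaAn W = (q : ℂ) ∧ padicValRat 2 q ≤ ((2 * padicValNat 2 (addOrderOf x) : ℕ) : ℤ) := by
  haveI : Fact (Nat.Prime 2) := ⟨Nat.prime_two⟩
  have hr1 : W.analyticRank ≤ 1 := by rw [hr]; exact zero_le_one
  have hrk : W.mordellWeilRank = 0 := by rw [(hGZK W hr1).1, hr]
  exact missingLowerBoundAt_iff_orderWitness_of_sha_torsionBy_le W 2 hCT hGZK hr1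
    (natCard_sha_torsionBy_le_of_selmer_count W 2 hrk hs (by convert ht using 4; simp only [Nat.cast_ofNat]; convert Iff.rfl) hst)

/-- **C3″ at `W` ⟺ an order witness at ANY globally minimal member `W'` of its class carrying the first-descent
datum** (the lower half is a Cassels isogeny invariant in analytic rank `≤ 1`, both directions:
`TwistComparison.missingLowerBoundAt_of_isIsogenous`). So the per-class certificate of p650635 may be sought at the
member where the descent is cheapest, and its ABSENCE there (no element `x` with `ord₂ #Ш_an(W') ≤ 2 ord₂ (ord x)`)
would REFUTE C3″. Conditional on `hCT`, Cassels `hCassels`, `hGZK`, modularity `hmod` and the descent slot at `W'`.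
[cite: MilneADT2006, Thm. I.7.3] [cite: SilvermanAEC2009, Thm. X.4.2 and Thm. X.4.14] [cite: Miller2011LMS, Def. 1.1] -/
theorem addPotGoodLower_two_iff_orderWitness_at_member (hCT : exists_casselsTate_pairing (K := ℚ))
    (hCassels : bsdRHS_eq_of_isIsogenous) (hGZK : rank_eq_analyticRank_of_analyticRank_le_one)
    (hmod : hasEntireLFunction_rat) (W : WeierstrassCurve ℚ) [W.IsElliptic] [W.IsGloballyMinimal]
    (_hcm : ¬ W.HasCM) (hr : W.analyticRank = 0) (_hadd : Addv W 2) (_hj : 0 ≤ padicValRat 2 W.j)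
    (W' : WeierstrassCurve ℚ) [W'.IsElliptic] [W'.IsGloballyMinimal] (hiso : IsIsogenous W W') {s t : ℕ}
    (hs : Nat.card (W'.selmerGroup 2) = 2 ^ s) (ht : Nat.card (W'.toAffine.Point[(2 : ℤ)]) = 2 ^ t)
    (hst : s ≤ t + 2) :
    MissingLowerBoundAt W 2 ↔
      ∃ (q' : ℚ) (x' : W'.sha), shaAn W' = (q' : ℂ) ∧
        padicValRat 2 q' ≤ ((2 * padicValNat 2 (addOrderOf x') : ℕ) : ℤ) := by
  haveI : Fact (Nat.Prime 2) := ⟨Nat.prime_two⟩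
  have hr1 : W.analyticRank ≤ 1 := by rw [hr]; exact zero_le_one
  have hr1' : W'.analyticRank ≤ 1 := by rwa [← analyticRank_eq_of_isIsogenous' hiso]
  have hrk' : W'.mordellWeilRank = 0 := by
    rw [(hGZK W' hr1').1, ← analyticRank_eq_of_isIsogenous' hiso, hr]
  rw [← missingLowerBoundAt_iff_orderWitness_of_sha_torsionBy_le W' 2 hCT hGZK hr1'
    (natCard_sha_torsionBy_le_of_selmer_count W' 2 hrk' hs (by convert ht using 4; simp only [Nat.cast_ofNat]; convert Iff.rfl) hst)]
  exact ⟨TwistComparison.missingLowerBoundAt_of_isIsogenous W W' 2 hCassels hGZK hmod hiso hr1,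
    TwistComparison.missingLowerBoundAt_of_isIsogenous W' W 2 hCassels hGZK hmod hiso.symm_of_charZero hr1'⟩

/-- **The census as a TEST of C3″**: the child `AdditivePotGoodLowerHalfAtTwo` forces, on every row carrying the
first-descent datum `s ≤ t + 2`, an element `x ∈ Ш(W)` with `ord₂ #Ш_an(W) ≤ 2 · ord₂ (ord x)` — so ONE census member
(`#Ш_an = 16`, `s = t + 2`) whose `8`-descent returned `Ш[4] = Ш[2]` (no element of order `4`) would REFUTE the child
(and BSD). None is known; the prediction is `Ш[2^∞] ≅ (ℤ/4)²` on 1 392 classes. Conditional on `hCT`, `hGZK` and the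
descent slot. [cite: SilvermanAEC2009, Thm. X.4.2 and Thm. X.4.14] [cite: Miller2011LMS, Def. 1.1] -/
theorem orderWitness_of_additivePotGoodLowerHalfAtTwo_of_selmerTwo (hCT : exists_casselsTate_pairing (K := ℚ))
    (hGZK : rank_eq_analyticRank_of_analyticRank_le_one) (h : AdditivePotGoodLowerHalfAtTwo)
    (W : WeierstrassCurve ℚ) [W.IsElliptic] [W.IsGloballyMinimal] (hcm : ¬ W.HasCM) (hr : W.analyticRank = 0)
    (hadd : Addv W 2) (hj : 0 ≤ padicValRat 2 W.j) {s t : ℕ} (hs : Nat.card (W.selmerGroup 2) = 2 ^ s)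
    (ht : Nat.card (W.toAffine.Point[(2 : ℤ)]) = 2 ^ t) (hst : s ≤ t + 2) :
    ∃ (q : ℚ) (x : W.sha), shaAn W = (q : ℂ) ∧ padicValRat 2 q ≤ ((2 * padicValNat 2 (addOrderOf x) : ℕ) : ℤ) :=
  (addPotGoodLower_two_iff_orderWitness_of_selmerTwo hCT hGZK W hcm hr hadd hj hs ht hst).mp (h W hcm hr hadd hj)

end Summit.BirchSwinnertonDyer.BirchSwinnertonDyer.Theorems.AddKatoTwo

end
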